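import Mathlib

/-!
# BSD rank-≤1 residual cell, class X11b @ 3 — the arithmetic step of the ANALYTIC class-number certificate (Friedman's criterion)

HONEST FRAMING (cell `b2b-bsdres-*`): this file books NOTHING; it is the elementary inference used by every analytic-road record
(x9 route 2, X9-CENSUS-G32 §2 (C1)–(C2); x11b GEN 13, `HOME/b2b-bsdres-x11b/g13/ANALYTIC-ROAD.md` §1): from a certified enclosure of
`A = h·R` (true class number `h`, true regulator `R`), the regulator `R~ = k·R` of a finite-index subgroup of the units (`k ≥ 1` the
unknown unit index), a lower bound `R ≥ R₀ > 0` valid for every number field (Friedman 1989: `R₀ = 0.2052`; cited in the records,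
not here), the computed (GRH) class number `h~`, and the CRITERION `|A/R~ − h~|·(R~/R₀) < ½`, conclude `h = k·h~`; and if a prime `p`
does not divide `k` (unit `p`-saturation certificate) then `v_p(h) = v_p(h~)`. Pure arithmetic; no number theory is formalised here.
X11 ∧ r = 1 ∧ p = 3 stays CONSTRUCTION-SHAPED (R6.2); not "finishing BSD".
-/

namespace Summit.BirchSwinnertonDyer.Rank1Residual.X11b.AnalyticClassNumberCriterion

/-- **Friedman's criterion, arithmetic form.** If `A = h·R`, `R~ = k·R` with `k ≥ 1`, `0 < R₀ ≤ R`, and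
`|A/R~ − h~|·(R~/R₀) < ½`, then `h = k·h~` (`h/k = A/R~` exactly, `k ≤ R~/R₀`, so `|h − k·h~| = k·|A/R~ − h~| < ½`). -/
theorem classNumber_eq_index_mul {h hT k : ℕ} {A R RT R₀ : ℝ} (hk : 0 < k) (hR₀ : 0 < R₀) (hR : R₀ ≤ R)
    (hRT : RT = k * R) (hA : A = h * R) (hcrit : |A / RT - hT| * (RT / R₀) < 1 / 2) : h = k * hT := by
  have hRpos : 0 < R := lt_of_lt_of_le hR₀ hR
  have hkR : (0 : ℝ) < k := by exact_mod_cast hk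
  have hRTpos : 0 < RT := by rw [hRT]; positivity
  -- A / RT = h / k
  have hquot : A / RT = (h : ℝ) / k := by
    rw [hA, hRT]; field_simp
  -- k ≤ RT / R₀
  have hkle : (k : ℝ) ≤ RT / R₀ := by
    rw [hRT, le_div_iff₀ hR₀]
    have : (k : ℝ) * R₀ ≤ k * R := by exact mul_le_mul_of_nonneg_left hR hkR.le
    simpa [mul_comm] using this
  have habs : |(h : ℝ) - k * hT| < 1 / 2 := by
    have h1 : |(h : ℝ) / k - hT| * k ≤ |A / RT - hT| * (RT / R₀) := by
      rw [hquot]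
      exact mul_le_mul_of_nonneg_left hkle (abs_nonneg _)
    have h2 : |(h : ℝ) / k - hT| * k = |(h : ℝ) - k * hT| := by
      rw [← abs_of_pos hkR, ← abs_mul, abs_of_pos hkR]
      congr 1
      field_simp
    linarith [h1, h2.symm.le, h2.le]
  -- integers closer than 1/2 are equal
  have hint : |((h : ℤ) - (k * hT : ℕ) : ℤ)| < 1 := by
    have : |((h : ℤ) - (k * hT : ℕ) : ℝ)| < 1 := by
      push_cast
      linarith [habs]
    exact_mod_cast this
  have hzero : (h : ℤ) - (k * hT : ℕ) = 0 := Int.abs_lt_one_iff.mp hint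
  omega

/-- If `h = k·h~` and the prime `p` does not divide the unit index `k`, the `p`-adic valuations of `h` and `h~` agree. -/
theorem padicValNat_classNumber_eq {p h hT k : ℕ} [hp : Fact p.Prime] (hhk : h = k * hT) (hndvd : ¬ p ∣ k) :
    padicValNat p h = padicValNat p hT := by
  subst hhk
  rcases Nat.eq_zero_or_pos hT with hT0 | hTpos
  · simp [hT0]
  have hk0 : k ≠ 0 := by rintro rfl; exact hndvd (dvd_zero p)
  rw [padicValNat.mul hk0 hTpos.ne', padicValNat.eq_zero_of_not_dvd hndvd, zero_add]

/-- The two steps together, as used in the records: the criterion and `p ∤ k` give `v_p(h) = v_p(h~)`. -/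
theorem padicValNat_classNumber_eq_of_criterion {p h hT k : ℕ} [Fact p.Prime] {A R RT R₀ : ℝ} (hk : 0 < k)
    (hR₀ : 0 < R₀) (hR : R₀ ≤ R) (hRT : RT = k * R) (hA : A = h * R) (hcrit : |A / RT - hT| * (RT / R₀) < 1 / 2)
    (hndvd : ¬ p ∣ k) : padicValNat p h = padicValNat p hT :=
  padicValNat_classNumber_eq (classNumber_eq_index_mul hk hR₀ hR hRT hA hcrit) hndvd

end Summit.BirchSwinnertonDyer.Rank1Residual.X11b.AnalyticClassNumberCriterion

namespace Summit.BirchSwinnertonDyer.Rank1Residual.X11b.AnalyticClassNumberCriterion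

/-! ## The CORNER-CHECK form of the criterion (REFEREE 2 R2-160.2, referee A R226.5 (iii) / R227.6 (i); x11b GEN 14)

A record holds ENCLOSURES, not values: `A ∈ [Alo, Ahi]` (engine 1 = PARI `lfun`, engine 2 = the Arb ball) and `R~ ∈ [Rlo, Rhi]`
(`Rlo > 0`). At fixed `h~` the criterion is the linear inequality `|A − h~·R~| < R₀/2`, and `|A − h~·R~|` is convex on the box, so it is
enough to check the four corners. Pure real arithmetic; books nothing. -/

/-- At fixed `h~` and `R~ > 0` the Friedman criterion `|A/R~ − h~|·(R~/R₀) < ½` is the LINEAR inequality `|A − h~·R~| < R₀/2`. -/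
theorem criterion_iff_abs_sub_lt {A RT R₀ : ℝ} {hT : ℕ} (hRT : 0 < RT) (hR₀ : 0 < R₀) :
    |A / RT - hT| * (RT / R₀) < 1 / 2 ↔ |A - hT * RT| < R₀ / 2 := by
  have h1 : |A / RT - hT| * (RT / R₀) = |A - hT * RT| / R₀ := by
    have : A / RT - hT = (A - hT * RT) / RT := by field_simp
    rw [this, abs_div, abs_of_pos hRT]
    field_simp
  rw [h1, div_lt_iff₀ hR₀]
  constructor <;> intro h <;> linarith

/-- `|a − c·r|` on a box is bounded by its maximum over the four corners (it is affine in each variable separately). -/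
theorem abs_sub_mul_le_corners {A Alo Ahi R Rlo Rhi c : ℝ} (hA : A ∈ Set.Icc Alo Ahi) (hR : R ∈ Set.Icc Rlo Rhi) :
    |A - c * R| ≤ max (max |Alo - c * Rlo| |Alo - c * Rhi|) (max |Ahi - c * Rlo| |Ahi - c * Rhi|) := by
  obtain ⟨hA1, hA2⟩ := hA
  obtain ⟨hR1, hR2⟩ := hR
  -- in the `A` direction the map is increasing
  have stepA : |A - c * R| ≤ max |Alo - c * R| |Ahi - c * R| :=
    abs_le_max_abs_abs (by linarith) (by linarith)
  -- in the `R` direction the map is monotone (either way): `a − c·R` lies between the two endpoint values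
  have stepR : ∀ a : ℝ, |a - c * R| ≤ max |a - c * Rlo| |a - c * Rhi| := by
    intro a
    rcases le_total 0 c with hc | hc
    · -- `c ≥ 0`: decreasing in `R`
      have h1 : a - c * Rhi ≤ a - c * R := by nlinarith
      have h2 : a - c * R ≤ a - c * Rlo := by nlinarith
      rw [max_comm]
      exact abs_le_max_abs_abs h1 h2
    · -- `c ≤ 0`: increasing in `R`
      have h1 : a - c * Rlo ≤ a - c * R := by nlinarith
      have h2 : a - c * R ≤ a - c * Rhi := by nlinarith
      exact abs_le_max_abs_abs h1 h2
  calc |A - c * R| ≤ max |Alo - c * R| |Ahi - c * R| := stepA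
    _ ≤ max (max |Alo - c * Rlo| |Alo - c * Rhi|) (max |Ahi - c * Rlo| |Ahi - c * Rhi|) :=
        max_le_max (stepR Alo) (stepR Ahi)

/-- **Corner check (R2-160.2).** If the four corner values of `|A − h~·R~|` over the enclosure box `[Alo, Ahi] × [Rlo, Rhi]`
(`Rlo > 0`) are `< R₀/2`, the Friedman criterion holds at EVERY point of the box — in particular at the true `(A, R~)`, whichever
engine's enclosure the box is. -/
theorem criterion_of_corner_check {A Alo Ahi RT Rlo Rhi R₀ : ℝ} {hT : ℕ} (hA : A ∈ Set.Icc Alo Ahi)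
    (hRT : RT ∈ Set.Icc Rlo Rhi) (hRlo : 0 < Rlo) (hR₀ : 0 < R₀)
    (h₁ : |Alo - hT * Rlo| < R₀ / 2) (h₂ : |Alo - hT * Rhi| < R₀ / 2) (h₃ : |Ahi - hT * Rlo| < R₀ / 2)
    (h₄ : |Ahi - hT * Rhi| < R₀ / 2) : |A / RT - hT| * (RT / R₀) < 1 / 2 := by
  have hRTpos : 0 < RT := lt_of_lt_of_le hRlo hRT.1
  rw [criterion_iff_abs_sub_lt hRTpos hR₀]
  calc |A - hT * RT| ≤ max (max |Alo - hT * Rlo| |Alo - hT * Rhi|) (max |Ahi - hT * Rlo| |Ahi - hT * Rhi|) :=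
        abs_sub_mul_le_corners hA hRT
    _ < R₀ / 2 := max_lt (max_lt h₁ h₂) (max_lt h₃ h₄)

/-- The corner check composed with `classNumber_eq_index_mul`: four corner inequalities on the record's enclosures of `A = h·R` and
`R~ = k·R` give `h = k·h~` (and then `padicValNat_classNumber_eq` gives `v_p(h) = v_p(h~)` from `p ∤ k`). -/
theorem classNumber_eq_index_mul_of_corner_check {h hT k : ℕ} {A Alo Ahi R RT Rlo Rhi R₀ : ℝ} (hk : 0 < k)
    (hR₀ : 0 < R₀) (hR : R₀ ≤ R) (hRTk : RT = k * R) (hAh : A = h * R) (hA : A ∈ Set.Icc Alo Ahi)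
    (hRT : RT ∈ Set.Icc Rlo Rhi) (hRlo : 0 < Rlo)
    (h₁ : |Alo - hT * Rlo| < R₀ / 2) (h₂ : |Alo - hT * Rhi| < R₀ / 2) (h₃ : |Ahi - hT * Rlo| < R₀ / 2)
    (h₄ : |Ahi - hT * Rhi| < R₀ / 2) : h = k * hT :=
  classNumber_eq_index_mul hk hR₀ hR hRTk hAh (criterion_of_corner_check hA hRT hRlo hR₀ h₁ h₂ h₃ h₄)

end Summit.BirchSwinnertonDyer.Rank1Residual.X11b.AnalyticClassNumberCriterion
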